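import Literature.AlgebraicGeometry.Motives.MixedHodgeStructureKrullSchmidt
import Literature.AlgebraicGeometry.Motives.MixedHodgeStructureIndecomposableDecomposition
import HarnessLib

/-!
# The Krull–Schmidt theorem for mixed Hodge structures: uniqueness of the indecomposable summands

In the abelian category of mixed Hodge structures on finite-dimensional `ℚ`-spaces (Cattani–El Zein–Griffiths–Lê,
*Hodge Theory*, Thm. 3.2.18; semisimple objects p. 270) every object is a finite direct sum of indecomposable
sub-MHS (the tree's `exists_iSupIndep_isIndecomposable`) and indecomposable objects have local endomorphism rings
(`IsIndecomposable.exists_bijective_of_sum_eq_id`). This file proves the **uniqueness half of the Krull–Schmidt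
theorem** — Lam's *Krull–Schmidt–Azumaya theorem* (19.21) — following Lam's printed proof step by step: for two
decompositions `H = ⊕ᵢ Sᵢ = ⊕ₖ Tₖ` into indecomposable sub-MHS, with projections `αᵢ`, `βₖ`,

1. `1_{S_{i₀}} = Σₖ α_{i₀} βₖ |_{S_{i₀}}` in the local ring `End(S_{i₀})`, so some `α_{i₀} βₖ |_{S_{i₀}}` is an
   automorphism and `βₖ : S_{i₀} → Tₖ` is a split monomorphism, hence an isomorphism as `Tₖ` is indecomposable
   (§2, `IsIndecomposable.exists_bijective_proj_comp_subtype`);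
2. then `H = S_{i₀} ⊕ (⊕_{l ≠ k} T_l)` (Lam's (19.24); §2, `isCompl_supNe_of_bijective`) and
   `⊕_{l ≠ k} T_l ≅ H / S_{i₀} ≅ ⊕_{i ≠ i₀} Sᵢ` (§2, `bijective_proj_supNe_comp_subtype`);
3. induction on the number of summands, transporting the two decompositions of `⊕_{i ≠ i₀} Sᵢ ≅ ⊕_{l ≠ k} T_l`
   along this isomorphism (§3) — §4, **`krullSchmidt`**: `∃ σ : Fin n ≃ Fin m, Sᵢ ≅ T_{σ i}`; hence `n = m`
   (`eq_of_decompositions`), the versions for arbitrary finite index types and for `DirectSum.IsInternal`, and the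
   well-definedness of the number and the dimensions of the indecomposable summands.

§1 supplies the complement `supNe S i = Σ_{j ≠ i} Sⱼ` of a member of an independent spanning family and the
projections `proj S _ _ i : H → Sᵢ` with `Σᵢ projᵢ = id`. Namespace `MixedHodgeStructure`; everything proved, no
named facts.

## References

* [Lam2001FirstCourse] T. Y. Lam, A First Course in Noncommutative Rings, 2nd ed., GTM 131 (2001), Thm. (19.21)
  (Krull–Schmidt–Azumaya) and its proof with (19.24), pp. 287–288; Cor. (19.22).
* [CattaniElZeinGriffithsLe2014] E. Cattani et al. (eds.), Hodge Theory (2014), Thm. 3.2.18, Lemma 3.2.20, p. 270.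
-/

noncomputable section

namespace Literature.AlgebraicGeometry.Motives

namespace MixedHodgeStructure

universe u v w u'

variable {V : Type u} [AddCommGroup V] [Module ℚ V]
variable {H : MixedHodgeStructure V}

open Module

/-! ### §1 The complement `Σ_{j ≠ i} Sⱼ` and the projections of a decomposition `H = ⊕ᵢ Sᵢ` -/

namespace SubMixedHodgeStructure

variable {ι : Type v} (S : ι → SubMixedHodgeStructure H)

/-- The sub-MHS `Σ_{j ≠ i} Sⱼ` — the complement of `Sᵢ` in a decomposition `H = ⊕ⱼ Sⱼ` (Lam: `Ker αᵢ`).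
[cite: Lam2001FirstCourse, Thm. (19.21), proof, p. 288] -/
def supNe (i : ι) : SubMixedHodgeStructure H :=
  iSup fun j => iSup fun (_ : j ≠ i) => S j

/-- The underlying subspace of `supNe S i` (by `rfl`). [cite: Lam2001FirstCourse, Thm. (19.21), proof, p. 288] -/
@[simp]
theorem supNe_toSubmodule (i : ι) : (supNe S i).toSubmodule = ⨆ (j) (_ : j ≠ i), (S j).toSubmodule := rfl

/-- `Sⱼ ⊆ Σ_{l ≠ i} S_l` for `j ≠ i`. [cite: Lam2001FirstCourse, Thm. (19.21), proof, p. 288] -/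
theorem le_supNe {i j : ι} (h : j ≠ i) : (S j).toSubmodule ≤ (supNe S i).toSubmodule :=
  le_iSup₂_of_le (f := fun j (_ : j ≠ i) => (S j).toSubmodule) j h le_rfl

/-- For an independent family with `Σⱼ Sⱼ = H`: **`H = Sᵢ ⊕ Σ_{j ≠ i} Sⱼ`**.
[cite: Lam2001FirstCourse, Thm. (19.21), proof, p. 288] -/
theorem isCompl_supNe (hind : iSupIndep fun i => (S i).toSubmodule) (htop : (⨆ i, (S i).toSubmodule) = ⊤)
    (i : ι) : IsCompl (S i).toSubmodule (supNe S i).toSubmodule :=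
  ⟨hind i, codisjoint_iff.2 ((iSup_split_single (fun j => (S j).toSubmodule) i).symm.trans htop)⟩

/-- **The projection `αᵢ : H → Sᵢ` of the decomposition `H = ⊕ⱼ Sⱼ`** (onto `Sᵢ` along `Σ_{j ≠ i} Sⱼ`), a morphism
of mixed Hodge structures. [cite: Lam2001FirstCourse, Thm. (19.21), proof, p. 288] -/
def proj (hind : iSupIndep fun i => (S i).toSubmodule) (htop : (⨆ i, (S i).toSubmodule) = ⊤) (i : ι) :
    Hom H (S i).toMixedHodgeStructure :=
  projOfIsCompl (supNe S i) (S i) (isCompl_supNe S hind htop i).symm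

/-- `αᵢ` is the identity on `Sᵢ`. [cite: Lam2001FirstCourse, Thm. (19.21), proof, p. 288] -/
theorem proj_apply_coe (hind : iSupIndep fun i => (S i).toSubmodule) (htop : (⨆ i, (S i).toSubmodule) = ⊤)
    (i : ι) (x : ↥(S i).toSubmodule) : (proj S hind htop i).toLinearMap x = x :=
  projOfIsCompl_apply_of_mem_right _ _ _ x

/-- `αᵢ` kills `Sⱼ` for `j ≠ i`. [cite: Lam2001FirstCourse, Thm. (19.21), proof, p. 288] -/
theorem proj_apply_of_mem_ne (hind : iSupIndep fun i => (S i).toSubmodule) (htop : (⨆ i, (S i).toSubmodule) = ⊤)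
    {i j : ι} (h : j ≠ i) {x : V} (hx : x ∈ (S j).toSubmodule) : (proj S hind htop i).toLinearMap x = 0 :=
  projOfIsCompl_apply_of_mem_left _ _ _ (le_supNe S h hx)

/-- **`Σᵢ αᵢ = 1`** in `End(H)`. [cite: Lam2001FirstCourse, Thm. (19.21), proof, p. 288] -/
theorem sum_coe_proj_apply [Fintype ι] (hind : iSupIndep fun i => (S i).toSubmodule)
    (htop : (⨆ i, (S i).toSubmodule) = ⊤) (x : V) : ∑ i, ((proj S hind htop i).toLinearMap x : V) = x := by
  classical
  have hx : x ∈ ⨆ i, (S i).toSubmodule := by rw [htop]; exact Submodule.mem_top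
  refine Submodule.iSup_induction (fun i => (S i).toSubmodule)
    (motive := fun x => ∑ i, ((proj S hind htop i).toLinearMap x : V) = x) hx (fun k y hy => ?_) ?_
    (fun y z hy hz => ?_)
  · rw [Finset.sum_eq_single k (fun i _ hik => by
      rw [proj_apply_of_mem_ne S hind htop (Ne.symm hik) hy, Submodule.coe_zero]) (fun h => absurd (Finset.mem_univ k) h)]
    exact congrArg Subtype.val (proj_apply_coe S hind htop k ⟨y, hy⟩)
  · simp
  · simp only [map_add, Submodule.coe_add, Finset.sum_add_distrib, hy, hz]

end SubMixedHodgeStructure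

open SubMixedHodgeStructure

/-! ### §2 Lam's exchange step: `S_{i₀} ≅ Tₖ`, `H = S_{i₀} ⊕ Σ_{l ≠ k} T_l`, `Σ_{i ≠ i₀} Sᵢ ≅ Σ_{l ≠ k} T_l` -/

section Exchange

variable [FiniteDimensional ℚ V]
variable {ι : Type v} {κ : Type w} {S : ι → SubMixedHodgeStructure H} {T : κ → SubMixedHodgeStructure H}

/-- **Exchange.** For decompositions `H = ⊕ᵢ Sᵢ = ⊕ₖ Tₖ` with `S_{i₀}` and all `Tₖ` indecomposable, some projection
`βₖ` restricts to an isomorphism `S_{i₀} ⥲ Tₖ`: `1_{S_{i₀}} = Σₖ α_{i₀} βₖ |_{S_{i₀}}` in the local ring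
`End(S_{i₀})`, so one `α_{i₀} βₖ |_{S_{i₀}}` is an automorphism, `βₖ |_{S_{i₀}}` is a split monomorphism, and an
isomorphism because `Tₖ` is indecomposable. [cite: Lam2001FirstCourse, Thm. (19.21), proof, p. 288] -/
theorem IsIndecomposable.exists_bijective_proj_comp_subtype [Fintype κ]
    (hS : iSupIndep fun i => (S i).toSubmodule) (hS' : (⨆ i, (S i).toSubmodule) = ⊤)
    (hT : iSupIndep fun k => (T k).toSubmodule) (hT' : (⨆ k, (T k).toSubmodule) = ⊤) {i₀ : ι}
    (h₀ : (S i₀).toMixedHodgeStructure.IsIndecomposable)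
    (hTi : ∀ k, (T k).toMixedHodgeStructure.IsIndecomposable) :
    ∃ k, Function.Bijective ((proj T hT hT' k).comp (S i₀).subtype).toLinearMap := by
  classical
  haveI := h₀.nontrivial
  set p : Hom H (S i₀).toMixedHodgeStructure := proj S hS hS' i₀ with hp
  let f : κ → Hom (S i₀).toMixedHodgeStructure (S i₀).toMixedHodgeStructure := fun k =>
    (p.comp (T k).subtype).comp ((proj T hT hT' k).comp (S i₀).subtype)
  have hsum : ∑ k ∈ Finset.univ, (f k).toLinearMap = LinearMap.id := by
    refine LinearMap.ext fun x => ?_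
    rw [LinearMap.sum_apply, LinearMap.id_apply]
    have h1 : ∀ k, (f k).toLinearMap x = p.toLinearMap (((proj T hT hT' k).toLinearMap (x : V) : V)) :=
      fun k => rfl
    simp only [h1]
    rw [← map_sum, sum_coe_proj_apply T hT hT' (x : V)]
    exact proj_apply_coe S hS hS' i₀ x
  obtain ⟨k, -, hk⟩ := h₀.exists_bijective_of_sum_eq_id Finset.univ f hsum
  exact ⟨k, (hTi k).bijective_of_comp_bijective _ (p.comp (T k).subtype) hk⟩

/-- **Lam's (19.24): if `βₖ : S_{i₀} ⥲ Tₖ` then `H = S_{i₀} ⊕ Σ_{l ≠ k} T_l`.**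
[cite: Lam2001FirstCourse, Thm. (19.21), proof, (19.24), p. 288] -/
theorem isCompl_supNe_of_bijective (hT : iSupIndep fun k => (T k).toSubmodule)
    (hT' : (⨆ k, (T k).toSubmodule) = ⊤) {i₀ : ι} {k : κ}
    (hk : Function.Bijective ((proj T hT hT' k).comp (S i₀).subtype).toLinearMap) :
    IsCompl (S i₀).toSubmodule (supNe T k).toSubmodule :=
  isCompl_of_bijective_proj_comp_subtype (isCompl_supNe T hT hT' k) hk

/-- **`Σ_{i ≠ i₀} Sᵢ ≅ Σ_{l ≠ k} T_l`** (both are complements of `S_{i₀}`, i.e. `≅ H / S_{i₀}`): the projection onto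
`Σ_{l ≠ k} T_l` along `S_{i₀}` restricts to an isomorphism on `Σ_{i ≠ i₀} Sᵢ`.
[cite: Lam2001FirstCourse, Thm. (19.21), proof, p. 288] -/
theorem bijective_proj_supNe_comp_subtype (hS : iSupIndep fun i => (S i).toSubmodule)
    (hS' : (⨆ i, (S i).toSubmodule) = ⊤) (hT : iSupIndep fun k => (T k).toSubmodule)
    (hT' : (⨆ k, (T k).toSubmodule) = ⊤) {i₀ : ι} {k : κ}
    (hk : Function.Bijective ((proj T hT hT' k).comp (S i₀).subtype).toLinearMap) :
    Function.Bijective ((projOfIsCompl (S i₀) (supNe T k) (isCompl_supNe_of_bijective hT hT' hk)).comp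
      (supNe S i₀).subtype).toLinearMap :=
  bijective_proj_comp_subtype_of_isCompl_of_isCompl (isCompl_supNe S hS hS' i₀) _

end Exchange

/-! ### §3 Transporting a decomposition: restriction to a sub-MHS, push-forward along an isomorphism -/

section Transport

variable {ι : Type v}
variable {V' : Type w} [AddCommGroup V'] [Module ℚ V'] {H' : MixedHodgeStructure V'}

namespace SubMixedHodgeStructure

/-- An independent family `(Uᵢ)` of sub-MHS stays independent when restricted to a sub-MHS `P` (as the family
`(Uᵢ ∩ P)` of sub-MHS of `P`). [cite: Lam2001FirstCourse, Thm. (19.21), proof, p. 288] -/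
theorem iSupIndep_comap_subtype (P : SubMixedHodgeStructure H) {U : ι → SubMixedHodgeStructure H}
    (hU : iSupIndep fun i => (U i).toSubmodule) :
    iSupIndep fun i => ((U i).comap P.subtype).toSubmodule := by
  refine iSupIndep_def.2 fun i => ?_
  rw [Submodule.disjoint_def]
  intro x hx hx'
  have h1 : (x : V) ∈ (U i).toSubmodule := hx
  have h2 : (x : V) ∈ ⨆ (j) (_ : j ≠ i), (U j).toSubmodule := by
    have hm : P.toSubmodule.subtype x ∈
        Submodule.map P.toSubmodule.subtype (⨆ (j) (_ : j ≠ i), ((U j).comap P.subtype).toSubmodule) :=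
      Submodule.mem_map_of_mem hx'
    simp only [Submodule.map_iSup, comap_toSubmodule] at hm
    have hle : (⨆ (j) (_ : j ≠ i), Submodule.map P.toSubmodule.subtype
        ((U j).toSubmodule.comap P.subtype.toLinearMap)) ≤ ⨆ (j) (_ : j ≠ i), (U j).toSubmodule :=
      iSup₂_mono fun j _ => Submodule.map_comap_le _ _
    exact hle hm
  have h0 := Submodule.disjoint_def.1 (iSupIndep_def.1 hU i) _ h1 h2
  exact Subtype.ext h0

/-- If moreover `Σᵢ Uᵢ = P` with all `Uᵢ ⊆ P`, the restricted family spans `P`.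
[cite: Lam2001FirstCourse, Thm. (19.21), proof, p. 288] -/
theorem iSup_comap_subtype_eq_top (P : SubMixedHodgeStructure H) {U : ι → SubMixedHodgeStructure H}
    (hle : ∀ i, (U i).toSubmodule ≤ P.toSubmodule) (hsup : (⨆ i, (U i).toSubmodule) = P.toSubmodule) :
    (⨆ i, ((U i).comap P.subtype).toSubmodule) = ⊤ := by
  apply Submodule.map_injective_of_injective P.toSubmodule.injective_subtype
  have hmap : ∀ i, Submodule.map P.toSubmodule.subtype ((U i).comap P.subtype).toSubmodule = (U i).toSubmodule :=
    fun i => by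
      rw [comap_toSubmodule, show P.subtype.toLinearMap = P.toSubmodule.subtype from rfl,
        Submodule.map_comap_subtype]
      exact inf_eq_right.2 (hle i)
  simp only [Submodule.map_iSup, hmap, Submodule.map_top, Submodule.range_subtype]
  exact hsup

/-- For `U ⊆ P` the restriction `U ∩ P` (a sub-MHS of `P`) is isomorphic to `U`: the restriction of `P ↪ H` is a
bijective morphism `U ∩ P → U`. [cite: CattaniElZeinGriffithsLe2014, Lemma 3.2.20] -/
theorem bijective_restrictHom_comap_subtype (P U : SubMixedHodgeStructure H) (h : U.toSubmodule ≤ P.toSubmodule) :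
    Function.Bijective ((U.comap P.subtype).restrictHom U P.subtype (fun _ hx => hx)).toLinearMap := by
  refine ⟨fun x y hxy => ?_, fun u => ?_⟩
  · have h' := congrArg Subtype.val hxy
    simp only [coe_restrictHom_apply] at h'
    exact Subtype.ext (Subtype.ext h')
  · exact ⟨⟨⟨u, h u.2⟩, u.2⟩, Subtype.ext rfl⟩

/-- An independent family of sub-MHS stays independent under an injective morphism.
[cite: Lam2001FirstCourse, Thm. (19.21), proof, p. 288] -/
theorem iSupIndep_map_of_injective (φ : Hom H H') (hφ : Function.Injective φ.toLinearMap)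
    {U : ι → SubMixedHodgeStructure H} (hU : iSupIndep fun i => (U i).toSubmodule) :
    iSupIndep fun i => ((U i).map φ).toSubmodule :=
  LinearMap.iSupIndep_map φ.toLinearMap hφ hU

/-- A spanning family of sub-MHS stays spanning under a surjective morphism.
[cite: Lam2001FirstCourse, Thm. (19.21), proof, p. 288] -/
theorem iSup_map_eq_top_of_surjective (φ : Hom H H') (hφ : Function.Surjective φ.toLinearMap)
    {U : ι → SubMixedHodgeStructure H} (hsup : (⨆ i, (U i).toSubmodule) = ⊤) :
    (⨆ i, ((U i).map φ).toSubmodule) = ⊤ := by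
  simp only [map_toSubmodule]
  rw [← Submodule.map_iSup, hsup, Submodule.map_top, LinearMap.range_eq_top.2 hφ]

/-- Under an injective morphism `φ`, a sub-MHS `U` is isomorphic to its image `φ(U)` (via the restriction of `φ`).
[cite: CattaniElZeinGriffithsLe2014, Lemma 3.2.20] -/
theorem bijective_restrictHom_map (φ : Hom H H') (hφ : Function.Injective φ.toLinearMap)
    (U : SubMixedHodgeStructure H) :
    Function.Bijective (U.restrictHom (U.map φ) φ (fun _ hx => Submodule.mem_map_of_mem hx)).toLinearMap := by
  refine ⟨fun x y hxy => ?_, fun y => ?_⟩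
  · have h' := congrArg Subtype.val hxy
    simp only [coe_restrictHom_apply] at h'
    exact Subtype.ext (hφ h')
  · obtain ⟨y, hy⟩ := y
    rw [map_toSubmodule, Submodule.mem_map] at hy
    obtain ⟨x, hx, rfl⟩ := hy
    exact ⟨⟨x, hx⟩, Subtype.ext rfl⟩

end SubMixedHodgeStructure

/-- The composite of bijective morphisms is bijective. [folklore] -/
private theorem bijective_comp {V₂ : Type w} [AddCommGroup V₂] [Module ℚ V₂] {H₂ : MixedHodgeStructure V₂}
    {V₃ : Type u'} [AddCommGroup V₃] [Module ℚ V₃] {H₃ : MixedHodgeStructure V₃} (g : Hom H₂ H₃) (f : Hom H H₂)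
    (hg : Function.Bijective g.toLinearMap) (hf : Function.Bijective f.toLinearMap) :
    Function.Bijective (g.comp f).toLinearMap := by
  rw [Hom.comp_toLinearMap, LinearMap.coe_comp]
  exact hg.comp hf

/-- The inverse of a bijective morphism is bijective. [folklore] -/
private theorem bijective_inverse (f : Hom H H') (hf : Function.Bijective f.toLinearMap) :
    Function.Bijective (f.inverse hf).toLinearMap := by
  rw [Hom.inverse_toLinearMap]
  exact (LinearEquiv.ofBijective f.toLinearMap hf).symm.bijective

end Transport

/-! ### §4 The Krull–Schmidt theorem -/

section KrullSchmidt

/-- `Σ_{j ≠ k} f j = Σ_{i : Fin m} f (k.succAbove i)` over `Fin (m + 1)`. [folklore] -/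
private theorem iSup_ne_eq_iSup_succAbove {α : Type*} [CompleteLattice α] {m : ℕ} (f : Fin (m + 1) → α)
    (k : Fin (m + 1)) : (⨆ (j) (_ : j ≠ k), f j) = ⨆ i : Fin m, f (k.succAbove i) := by
  refine le_antisymm (iSup₂_le fun j hj => ?_) (iSup_le fun i => ?_)
  · obtain ⟨i, rfl⟩ := Fin.exists_succAbove_eq hj
    exact le_iSup (fun i => f (k.succAbove i)) i
  · exact le_iSup₂_of_le (f := fun j (_ : j ≠ k) => f j) (k.succAbove i) (Fin.succAbove_ne k i) le_rfl

/-- `Σ_{j ≠ 0} f j = Σ_{i : Fin n} f i.succ` over `Fin (n + 1)`. [folklore] -/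
private theorem iSup_ne_zero_eq_iSup_succ {α : Type*} [CompleteLattice α] {n : ℕ} (f : Fin (n + 1) → α) :
    (⨆ (j) (_ : j ≠ 0), f j) = ⨆ i : Fin n, f i.succ := by
  rw [iSup_ne_eq_iSup_succAbove f 0]
  exact iSup_congr fun i => by rw [Fin.succAbove_zero]

/-- The Krull–Schmidt theorem for `Fin`-indexed decompositions, by induction on the number of summands (all carriers
in one universe, so that the induction may pass to the sub-MHS `Σ_{l ≠ k} T_l`).
[cite: Lam2001FirstCourse, Thm. (19.21), proof, pp. 287–288] -/
private theorem krullSchmidt_aux (n : ℕ) : ∀ {W : Type u} [AddCommGroup W] [Module ℚ W] [FiniteDimensional ℚ W]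
    (G : MixedHodgeStructure W) (S : Fin n → SubMixedHodgeStructure G) {m : ℕ} (T : Fin m → SubMixedHodgeStructure G),
    iSupIndep (fun i => (S i).toSubmodule) → (⨆ i, (S i).toSubmodule) = ⊤ →
    (∀ i, (S i).toMixedHodgeStructure.IsIndecomposable) →
    iSupIndep (fun k => (T k).toSubmodule) → (⨆ k, (T k).toSubmodule) = ⊤ →
    (∀ k, (T k).toMixedHodgeStructure.IsIndecomposable) →
    ∃ σ : Fin n ≃ Fin m, ∀ i, ∃ e : Hom (S i).toMixedHodgeStructure (T (σ i)).toMixedHodgeStructure,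
      Function.Bijective e.toLinearMap := by
  induction n with
  | zero =>
    intro W _ _ _ G S m T hS hS' hSi hT hT' hTi
    -- `W = 0`, so `m = 0` (indecomposables are non-zero)
    have hW : (⊤ : Submodule ℚ W) = ⊥ := by rw [← hS', iSup_eq_bot]; exact fun i => i.elim0
    have hm : m = 0 := by
      by_contra hm
      obtain ⟨m, rfl⟩ := Nat.exists_eq_add_one_of_ne_zero hm
      haveI := (hTi 0).nontrivial
      obtain ⟨x, hx⟩ := exists_ne (0 : ↥(T 0).toSubmodule)
      apply hx
      have h0 : (x : W) ∈ (⊥ : Submodule ℚ W) := by rw [← hW]; exact Submodule.mem_top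
      exact Subtype.ext ((Submodule.mem_bot ℚ).1 h0)
    subst hm
    exact ⟨Equiv.refl _, fun i => i.elim0⟩
  | succ n ih =>
    intro W _ _ _ G S m T hS hS' hSi hT hT' hTi
    classical
    haveI := (hSi 0).nontrivial
    -- `m ≠ 0` since `W ≠ 0`
    have hm : m ≠ 0 := by
      rintro rfl
      have hW : (⊤ : Submodule ℚ W) = ⊥ := by rw [← hT', iSup_eq_bot]; exact fun k => k.elim0
      obtain ⟨x, hx⟩ := exists_ne (0 : ↥(S 0).toSubmodule)
      apply hx
      have h0 : (x : W) ∈ (⊥ : Submodule ℚ W) := by rw [← hW]; exact Submodule.mem_top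
      exact Subtype.ext ((Submodule.mem_bot ℚ).1 h0)
    obtain ⟨m, rfl⟩ := Nat.exists_eq_add_one_of_ne_zero hm
    -- Lam's exchange: `β_k : S 0 ⥲ T k`, `G = S 0 ⊕ Σ_{l ≠ k} T_l`, `φ : Σ_{i ≠ 0} S_i ⥲ Σ_{l ≠ k} T_l`
    obtain ⟨k, hk⟩ := (hSi 0).exists_bijective_proj_comp_subtype hS hS' hT hT' hTi
    have hc : IsCompl (S 0).toSubmodule (supNe T k).toSubmodule := isCompl_supNe_of_bijective hT hT' hk
    have hφ := bijective_proj_supNe_comp_subtype hS hS' hT hT' hk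
    set φ : Hom (supNe S 0).toMixedHodgeStructure (supNe T k).toMixedHodgeStructure :=
      (projOfIsCompl (S 0) (supNe T k) (isCompl_supNe_of_bijective hT hT' hk)).comp (supNe S 0).subtype with hφdef
    -- the two decompositions of `Σ_{l ≠ k} T_l`
    let A : Fin n → SubMixedHodgeStructure (supNe T k).toMixedHodgeStructure := fun i =>
      ((S i.succ).comap (supNe S 0).subtype).map φ
    let B : Fin m → SubMixedHodgeStructure (supNe T k).toMixedHodgeStructure := fun j =>
      (T (k.succAbove j)).comap (supNe T k).subtype
    have hleS : ∀ i : Fin n, (S i.succ).toSubmodule ≤ (supNe S 0).toSubmodule :=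
      fun i => le_supNe S (Fin.succ_ne_zero i)
    have hsupS : (⨆ i : Fin n, (S i.succ).toSubmodule) = (supNe S 0).toSubmodule := by
      rw [supNe_toSubmodule, iSup_ne_zero_eq_iSup_succ (fun j => (S j).toSubmodule)]
    have hleT : ∀ j : Fin m, (T (k.succAbove j)).toSubmodule ≤ (supNe T k).toSubmodule :=
      fun j => le_supNe T (Fin.succAbove_ne k j)
    have hsupT : (⨆ j : Fin m, (T (k.succAbove j)).toSubmodule) = (supNe T k).toSubmodule := by
      rw [supNe_toSubmodule, iSup_ne_eq_iSup_succAbove (fun j => (T j).toSubmodule) k]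
    have hA : iSupIndep fun i => (A i).toSubmodule :=
      iSupIndep_map_of_injective φ hφ.1
        (iSupIndep_comap_subtype (supNe S 0) (U := fun i : Fin n => S i.succ) (hS.comp (Fin.succ_injective n)))
    have hA' : (⨆ i, (A i).toSubmodule) = ⊤ :=
      iSup_map_eq_top_of_surjective φ hφ.2 (iSup_comap_subtype_eq_top (supNe S 0) hleS hsupS)
    have hAi : ∀ i, (A i).toMixedHodgeStructure.IsIndecomposable := fun i =>
      (((isIndecomposable_iff_of_bijective _
        (bijective_restrictHom_comap_subtype (supNe S 0) (S i.succ) (hleS i))).2 (hSi i.succ)).of_bijective _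
        (bijective_restrictHom_map φ hφ.1 _))
    have hB : iSupIndep fun j => (B j).toSubmodule :=
      iSupIndep_comap_subtype (supNe T k) (U := fun j : Fin m => T (k.succAbove j))
        (hT.comp Fin.succAbove_right_injective)
    have hB' : (⨆ j, (B j).toSubmodule) = ⊤ := iSup_comap_subtype_eq_top (supNe T k) hleT hsupT
    have hBi : ∀ j, (B j).toMixedHodgeStructure.IsIndecomposable := fun j =>
      (isIndecomposable_iff_of_bijective _
        (bijective_restrictHom_comap_subtype (supNe T k) (T (k.succAbove j)) (hleT j))).2 (hTi _)
    -- induction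
    obtain ⟨σ', hσ'⟩ := ih (supNe T k).toMixedHodgeStructure A B hA hA' hAi hB hB' hBi
    set σ : Fin (n + 1) ≃ Fin (m + 1) := ((finSuccEquiv n).trans (Equiv.optionCongr σ')).trans
      (finSuccEquiv' k).symm with hσdef
    refine ⟨σ, fun i => Fin.cases ?_ (fun i => ?_) i⟩
    · -- `S 0 ≅ T k = T (σ 0)`
      have hσ0 : σ 0 = k := by simp [hσdef]
      exact hσ0 ▸ ⟨(proj T hT hT' k).comp (S 0).subtype, hk⟩
    · -- `S i.succ ≅ (S i.succ ∩ Σ_{j ≠ 0} S_j) ≅ A i ≅ B (σ' i) ≅ T (k.succAbove (σ' i)) = T (σ i.succ)`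
      have hσs : σ i.succ = k.succAbove (σ' i) := by simp [hσdef]
      obtain ⟨e, he⟩ := hσ' i
      have hg₁ := bijective_restrictHom_comap_subtype (supNe S 0) (S i.succ) (hleS i)
      let e₁ : Hom (S i.succ).toMixedHodgeStructure ((S i.succ).comap (supNe S 0).subtype).toMixedHodgeStructure :=
        (((S i.succ).comap (supNe S 0).subtype).restrictHom (S i.succ) (supNe S 0).subtype (fun _ hx => hx)).inverse hg₁
      have he₁ : Function.Bijective e₁.toLinearMap := bijective_inverse _ hg₁
      let e₂ : Hom ((S i.succ).comap (supNe S 0).subtype).toMixedHodgeStructure (A i).toMixedHodgeStructure :=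
        ((S i.succ).comap (supNe S 0).subtype).restrictHom (A i) φ (fun _ hx => Submodule.mem_map_of_mem hx)
      have he₂ : Function.Bijective e₂.toLinearMap := bijective_restrictHom_map φ hφ.1 _
      let e₃ : Hom (B (σ' i)).toMixedHodgeStructure (T (k.succAbove (σ' i))).toMixedHodgeStructure :=
        (B (σ' i)).restrictHom (T (k.succAbove (σ' i))) (supNe T k).subtype (fun _ hx => hx)
      have he₃ : Function.Bijective e₃.toLinearMap :=
        bijective_restrictHom_comap_subtype (supNe T k) (T (k.succAbove (σ' i))) (hleT (σ' i))
      exact hσs ▸ ⟨e₃.comp (e.comp (e₂.comp e₁)),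
        bijective_comp _ _ he₃ (bijective_comp _ _ he (bijective_comp _ _ he₂ he₁))⟩

variable [FiniteDimensional ℚ V]

/-- **The Krull–Schmidt theorem for mixed Hodge structures (Lam's Krull–Schmidt–Azumaya theorem (19.21)).** If
`H = ⊕_{i < n} Sᵢ = ⊕_{k < m} Tₖ` are two decompositions into indecomposable sub-MHS, there is a bijection
`σ : Fin n ≃ Fin m` with `Sᵢ ≅ T_{σ i}` as mixed Hodge structures for all `i`.
[cite: Lam2001FirstCourse, Thm. (19.21), pp. 287–288] [cite: CattaniElZeinGriffithsLe2014, Thm. 3.2.18 and p. 270] -/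
theorem krullSchmidt {n m : ℕ} (S : Fin n → SubMixedHodgeStructure H) (T : Fin m → SubMixedHodgeStructure H)
    (hS : iSupIndep fun i => (S i).toSubmodule) (hS' : (⨆ i, (S i).toSubmodule) = ⊤)
    (hSi : ∀ i, (S i).toMixedHodgeStructure.IsIndecomposable)
    (hT : iSupIndep fun k => (T k).toSubmodule) (hT' : (⨆ k, (T k).toSubmodule) = ⊤)
    (hTi : ∀ k, (T k).toMixedHodgeStructure.IsIndecomposable) :
    ∃ σ : Fin n ≃ Fin m, ∀ i, ∃ e : Hom (S i).toMixedHodgeStructure (T (σ i)).toMixedHodgeStructure,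
      Function.Bijective e.toLinearMap :=
  krullSchmidt_aux n H S T hS hS' hSi hT hT' hTi

/-- **The number of indecomposable summands is well defined**: `n = m` (Lam: `r = s`).
[cite: Lam2001FirstCourse, Thm. (19.21), p. 287] -/
theorem eq_of_decompositions {n m : ℕ} (S : Fin n → SubMixedHodgeStructure H) (T : Fin m → SubMixedHodgeStructure H)
    (hS : iSupIndep fun i => (S i).toSubmodule) (hS' : (⨆ i, (S i).toSubmodule) = ⊤)
    (hSi : ∀ i, (S i).toMixedHodgeStructure.IsIndecomposable)
    (hT : iSupIndep fun k => (T k).toSubmodule) (hT' : (⨆ k, (T k).toSubmodule) = ⊤)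
    (hTi : ∀ k, (T k).toMixedHodgeStructure.IsIndecomposable) : n = m := by
  obtain ⟨σ, -⟩ := krullSchmidt S T hS hS' hSi hT hT' hTi
  simpa using Fintype.card_congr σ

/-- The Krull–Schmidt theorem for decompositions indexed by arbitrary finite types: a bijection `σ : ι ≃ κ` of the
index types with `Sᵢ ≅ T_{σ i}`. [cite: Lam2001FirstCourse, Thm. (19.21), pp. 287–288] -/
theorem krullSchmidt_fintype {ι : Type v} {κ : Type w} [Fintype ι] [Fintype κ] (S : ι → SubMixedHodgeStructure H)
    (T : κ → SubMixedHodgeStructure H) (hS : iSupIndep fun i => (S i).toSubmodule)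
    (hS' : (⨆ i, (S i).toSubmodule) = ⊤) (hSi : ∀ i, (S i).toMixedHodgeStructure.IsIndecomposable)
    (hT : iSupIndep fun k => (T k).toSubmodule) (hT' : (⨆ k, (T k).toSubmodule) = ⊤)
    (hTi : ∀ k, (T k).toMixedHodgeStructure.IsIndecomposable) :
    ∃ σ : ι ≃ κ, ∀ i, ∃ e : Hom (S i).toMixedHodgeStructure (T (σ i)).toMixedHodgeStructure,
      Function.Bijective e.toLinearMap := by
  classical
  let eι := Fintype.equivFin ι
  let eκ := Fintype.equivFin κ
  obtain ⟨σ₀, h⟩ := krullSchmidt (fun a => S (eι.symm a)) (fun b => T (eκ.symm b))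
    (hS.comp eι.symm.injective) ((eι.symm.iSup_comp (g := fun i => (S i).toSubmodule)).trans hS')
    (fun a => hSi _) (hT.comp eκ.symm.injective)
    ((eκ.symm.iSup_comp (g := fun k => (T k).toSubmodule)).trans hT') (fun b => hTi _)
  refine ⟨eι.trans (σ₀.trans eκ.symm), fun i => ?_⟩
  have hi := h (eι i)
  rw [Equiv.symm_apply_apply] at hi
  exact hi

/-- The Krull–Schmidt theorem for internal direct sums `V = ⊕ᵢ Sᵢ = ⊕ₖ Tₖ` (`DirectSum.IsInternal`).
[cite: Lam2001FirstCourse, Thm. (19.21), pp. 287–288] -/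
theorem krullSchmidt_of_isInternal {ι : Type v} {κ : Type w} [Fintype ι] [Fintype κ] [DecidableEq ι]
    [DecidableEq κ] (S : ι → SubMixedHodgeStructure H) (T : κ → SubMixedHodgeStructure H)
    (hS : DirectSum.IsInternal fun i => (S i).toSubmodule)
    (hSi : ∀ i, (S i).toMixedHodgeStructure.IsIndecomposable)
    (hT : DirectSum.IsInternal fun k => (T k).toSubmodule)
    (hTi : ∀ k, (T k).toMixedHodgeStructure.IsIndecomposable) :
    ∃ σ : ι ≃ κ, ∀ i, ∃ e : Hom (S i).toMixedHodgeStructure (T (σ i)).toMixedHodgeStructure,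
      Function.Bijective e.toLinearMap :=
  krullSchmidt_fintype S T hS.submodule_iSupIndep hS.submodule_iSup_eq_top hSi hT.submodule_iSupIndep
    hT.submodule_iSup_eq_top hTi

/-- The numbers of summands of two indecomposable decompositions indexed by finite types agree.
[cite: Lam2001FirstCourse, Thm. (19.21), p. 287] -/
theorem card_eq_of_decompositions {ι : Type v} {κ : Type w} [Fintype ι] [Fintype κ]
    (S : ι → SubMixedHodgeStructure H) (T : κ → SubMixedHodgeStructure H)
    (hS : iSupIndep fun i => (S i).toSubmodule) (hS' : (⨆ i, (S i).toSubmodule) = ⊤)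
    (hSi : ∀ i, (S i).toMixedHodgeStructure.IsIndecomposable)
    (hT : iSupIndep fun k => (T k).toSubmodule) (hT' : (⨆ k, (T k).toSubmodule) = ⊤)
    (hTi : ∀ k, (T k).toMixedHodgeStructure.IsIndecomposable) : Fintype.card ι = Fintype.card κ := by
  obtain ⟨σ, -⟩ := krullSchmidt_fintype S T hS hS' hSi hT hT' hTi
  exact Fintype.card_congr σ

/-- **The dimensions of the indecomposable summands are well defined up to reindexing.**
[cite: Lam2001FirstCourse, Cor. (19.22), p. 288] -/
theorem exists_equiv_finrank_eq_of_decompositions {ι : Type v} {κ : Type w} [Fintype ι] [Fintype κ]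
    (S : ι → SubMixedHodgeStructure H) (T : κ → SubMixedHodgeStructure H)
    (hS : iSupIndep fun i => (S i).toSubmodule) (hS' : (⨆ i, (S i).toSubmodule) = ⊤)
    (hSi : ∀ i, (S i).toMixedHodgeStructure.IsIndecomposable)
    (hT : iSupIndep fun k => (T k).toSubmodule) (hT' : (⨆ k, (T k).toSubmodule) = ⊤)
    (hTi : ∀ k, (T k).toMixedHodgeStructure.IsIndecomposable) :
    ∃ σ : ι ≃ κ, ∀ i, finrank ℚ (S i).toSubmodule = finrank ℚ (T (σ i)).toSubmodule := by
  obtain ⟨σ, h⟩ := krullSchmidt_fintype S T hS hS' hSi hT hT' hTi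
  refine ⟨σ, fun i => ?_⟩
  obtain ⟨e, he⟩ := h i
  exact (LinearEquiv.ofBijective e.toLinearMap he).finrank_eq

/-- **Krull–Schmidt (Lam's Cor. (19.22)) for mixed Hodge structures**: `H` has a decomposition into finitely many
indecomposable sub-MHS, and for any two such decompositions the number of summands agrees and the summands are
pairwise isomorphic after a reindexing. [cite: Lam2001FirstCourse, Cor. (19.22), p. 288]
[cite: CattaniElZeinGriffithsLe2014, Thm. 3.2.18 and p. 270] -/
theorem krullSchmidt_exists_unique (H : MixedHodgeStructure V) :
    (∃ (n : ℕ) (S : Fin n → SubMixedHodgeStructure H), iSupIndep (fun i => (S i).toSubmodule) ∧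
      (⨆ i, (S i).toSubmodule) = ⊤ ∧ ∀ i, (S i).toMixedHodgeStructure.IsIndecomposable) ∧
    ∀ (n m : ℕ) (S : Fin n → SubMixedHodgeStructure H) (T : Fin m → SubMixedHodgeStructure H),
      iSupIndep (fun i => (S i).toSubmodule) → (⨆ i, (S i).toSubmodule) = ⊤ →
      (∀ i, (S i).toMixedHodgeStructure.IsIndecomposable) →
      iSupIndep (fun k => (T k).toSubmodule) → (⨆ k, (T k).toSubmodule) = ⊤ →
      (∀ k, (T k).toMixedHodgeStructure.IsIndecomposable) →
      n = m ∧ ∃ σ : Fin n ≃ Fin m, ∀ i,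
        ∃ e : Hom (S i).toMixedHodgeStructure (T (σ i)).toMixedHodgeStructure, Function.Bijective e.toLinearMap :=
  ⟨exists_iSupIndep_isIndecomposable H, fun _ _ S T hS hS' hSi hT hT' hTi =>
    ⟨eq_of_decompositions S T hS hS' hSi hT hT' hTi, krullSchmidt S T hS hS' hSi hT hT' hTi⟩⟩

end KrullSchmidt

end MixedHodgeStructure

end Literature.AlgebraicGeometry.Motives
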